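import Mathlib
import Summits.Ventures.PercRepro2.HCov
import Summits.Ventures.PercRepro2.GcSkelRules
import Summits.Ventures.PercRepro2.GcSkelReductionT
import Summits.Ventures.PercRepro2.GcSkelShapeT
import Summits.Ventures.PercRepro2.GcSkelReductionMin
import Summits.Ventures.PercRepro2.GcSkelShapeZ
import Summits.Ventures.PercRepro2.GcHatConn
import Summits.Ventures.PercRepro2.GcSkelReductionHat

/-!
# The shape of the class of record with no hat (blind cell PercRepro2, typer-1 g56)

On the class of record `WReducedMinHAZH` an unmarked vertex adjacent to both roots carries at
least two further non-loop edges: its non-loop degree is at least `3` (the degree clause), and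
exactly `3` would make it a hat (`exists_hat_of_deg_three`), which the class forbids —
**`deg_ge_four_of_wredMinHAZH`**. **`shape_of_wredMinHAZH`** adds this and the no-hat clause to
`shape_of_wredMinHAZ`. Standard axioms.
-/

namespace Summit.Ventures.PercRepro2

open CovForm RECM SepPair

namespace WRed

section Shape

variable {V : Type*} {E : Type*} [Fintype E] [DecidableEq E] [DecidableEq V]

/-- **Non-loop degree three with the two root edges = a hat**: a vertex `u` with `nonLoopDeg u = 3`
carrying the non-loop edges `e₁ = {u, a₁}`, `e₂ = {u, a₂}` is, on a simple graph, a hat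
`u ~ {a₁, a₂, w}`. -/
theorem exists_hat_of_deg_three {ends : E → Sym2 V} (hs : Simple ends) {u a₁ a₂ : V} {e₁ e₂ : E}
    (h1 : ends e₁ = s(u, a₁)) (h2 : ends e₂ = s(u, a₂)) (hu1 : u ≠ a₁) (hu2 : u ≠ a₂)
    (h12 : a₁ ≠ a₂) (hdeg : nonLoopDeg ends u = 3) :
    ∃ (w : V) (e₃ : E), Hat.IsHatAt ends u a₁ a₂ w e₁ e₂ e₃ := by
  have he1 : e₁ ∈ edgesAt ends u :=
    mem_edgesAt.2 ⟨by rw [h1]; simp, by rw [h1, Sym2.mk_isDiag_iff]; exact hu1⟩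
  have he2 : e₂ ∈ edgesAt ends u :=
    mem_edgesAt.2 ⟨by rw [h2]; simp, by rw [h2, Sym2.mk_isDiag_iff]; exact hu2⟩
  have hne12 : e₁ ≠ e₂ := by
    intro heq
    rw [heq, h2] at h1
    have := Sym2.eq_iff.1 h1
    rcases this with ⟨-, h⟩ | ⟨h, -⟩
    · exact h12 h.symm
    · exact hu1 h
  have hcard : (((edgesAt ends u).erase e₁).erase e₂).card = 1 := by
    rw [Finset.card_erase_of_mem (Finset.mem_erase.2 ⟨hne12.symm, he2⟩),
      Finset.card_erase_of_mem he1]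
    unfold nonLoopDeg at hdeg
    omega
  obtain ⟨e₃, he3⟩ := Finset.card_eq_one.1 hcard
  have hm3 : e₃ ∈ ((edgesAt ends u).erase e₁).erase e₂ := by
    rw [he3]; exact Finset.mem_singleton_self e₃
  rw [Finset.mem_erase, Finset.mem_erase] at hm3
  obtain ⟨hne32, hne31, hm3⟩ := hm3
  obtain ⟨hu3, hd3⟩ := mem_edgesAt.1 hm3
  obtain ⟨w, hw⟩ := Sym2.mem_iff_exists.1 hu3
  have hwu : w ≠ u := by
    intro hwu
    rw [hw, Sym2.mk_isDiag_iff] at hd3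
    exact hd3 hwu.symm
  have hw1 : w ≠ a₁ := by
    intro hwa
    exact hs e₃ e₁ hne31 hd3 (by rw [hw, hwa, h1])
  have hw2 : w ≠ a₂ := by
    intro hwa
    exact hs e₃ e₂ hne32 hd3 (by rw [hw, hwa, h2])
  refine ⟨w, e₃, ⟨by rw [h1, Sym2.eq_swap], by rw [h2, Sym2.eq_swap], by rw [hw, Sym2.eq_swap],
    hne12, hne31.symm, hne32.symm, hu1, hu2, hwu.symm, hw1, hw2, ?_⟩⟩
  intro g g1 g2 g3 hug
  by_contra hd
  have hg : g ∈ ((edgesAt ends u).erase e₁).erase e₂ :=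
    Finset.mem_erase.2 ⟨g2, Finset.mem_erase.2 ⟨g1, mem_edgesAt.2 ⟨hug, hd⟩⟩⟩
  rw [he3, Finset.mem_singleton] at hg
  exact g3 hg

/-- **On the class of record an unmarked vertex adjacent to both roots has non-loop degree at
least four.** -/
theorem deg_ge_four_of_wredMinHAZH {ends : E → Sym2 V} {o a₁ a₂ a₃ b : V}
    (h : WReducedMinHAZH ends o a₁ a₂ a₃ b) (h12 : a₁ ≠ a₂) {u : V} (hu : Unmarked o a₁ a₂ a₃ b u)
    {e₁ e₂ : E} (h1 : ends e₁ = s(u, a₁)) (h2 : ends e₂ = s(u, a₂)) : 4 ≤ nonLoopDeg ends u := by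
  have hMin : WReducedMin ends o a₁ a₂ a₃ b := h.toWReducedMin
  have hT : WReducedT ends o a₁ a₂ a₃ b := wredT_iff_wredMin.2 hMin
  obtain ⟨hd1, hd2⟩ := hT.unmarked u hu
  have he1 : e₁ ∈ edgesAt ends u :=
    mem_edgesAt.2 ⟨by rw [h1]; simp, by rw [h1, Sym2.mk_isDiag_iff]; exact hu.2.1⟩
  have hpos : 1 ≤ nonLoopDeg ends u := Finset.card_pos.2 ⟨e₁, he1⟩
  by_contra hlt
  have hdeg : nonLoopDeg ends u = 3 := by omega
  obtain ⟨w, e₃, hhat⟩ := exists_hat_of_deg_three hMin.simple h1 h2 hu.2.1 hu.2.2.1 h12 hdeg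
  exact h.noHat ⟨u, w, e₁, e₂, e₃, hu, hhat⟩

/-- **THE SHAPE OF THE CLASS OF RECORD WITH NO HAT IN ONE STATEMENT**: the shape of
`WReducedMinHAZ`, no hat, and every unmarked vertex adjacent to both roots of non-loop degree at
least four. -/
theorem shape_of_wredMinHAZH {ends : E → Sym2 V} {o a₁ a₂ a₃ b : V}
    (h : WReducedMinHAZH ends o a₁ a₂ a₃ b)
    (h12 : a₁ ≠ a₂) (h13 : a₁ ≠ a₃) (h23 : a₂ ≠ a₃) (ho1 : o ≠ a₁) (ho2 : o ≠ a₂) (ho3 : o ≠ a₃)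
    (hob : o ≠ b) (hb1 : b ≠ a₁) (hb2 : b ≠ a₂) (hb3 : b ≠ a₃) :
    (Simple ends ∧
    (∀ y, Unmarked o a₁ a₂ a₃ b y → nonLoopDeg ends y = 0 ∨ 3 ≤ nonLoopDeg ends y) ∧
    (nonLoopDeg ends o ≠ 1 ∧ nonLoopDeg ends b ≠ 1 ∧ nonLoopDeg ends a₁ ≠ 1 ∧
      nonLoopDeg ends a₂ ≠ 1) ∧
    (¬ IsolatedMark.IsIsolated ends a₁ ∧ ¬ IsolatedMark.IsIsolated ends a₂ ∧
      ¬ IsolatedMark.IsIsolated ends o ∧ ¬ IsolatedMark.IsIsolated ends b) ∧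
    (∀ v x y : V, x ≠ v → y ≠ v → x ≠ a₃ → y ≠ a₃ → (∃ e, x ∈ ends e ∧ ¬ (ends e).IsDiag) →
      (∃ e, y ∈ ends e ∧ ¬ (ends e).IsDiag) → Conn ends (sepConfig ends {v}) x y) ∧
    MarksReach ends o a₁ a₂ a₃ b ∧
    (∀ (W : Set V) (u v : V), Block.IsBlock ends W u v → (∀ y ∈ W, Unmarked o a₁ a₂ a₃ b y) →
      ∀ y ∈ W, nonLoopDeg ends y = 0) ∧
    (∃ (e : E) (x : V), ends e = s(o, x) ∧ x ≠ o ∧ x ≠ a₁ ∧ x ≠ a₂ ∧ x ≠ b) ∧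
    (∃ (e : E) (x : V), ends e = s(o, x) ∧ x ≠ o ∧ x ≠ a₃ ∧ x ≠ b) ∧
    (∃ (e : E) (x : V), ends e = s(b, x) ∧ x ≠ b ∧ x ≠ a₁ ∧ x ≠ a₂ ∧ x ≠ o) ∧
    (∃ (e : E) (x : V), (ends e = s(o, x) ∨ ends e = s(b, x)) ∧ Unmarked o a₁ a₂ a₃ b x) ∧
    (∃ (e : E) (x : V), ends e = s(a₃, x) ∧ Unmarked o a₁ a₂ a₃ b x) ∧
    (∃ x y : V, x ≠ y ∧ Unmarked o a₁ a₂ a₃ b x ∧ Unmarked o a₁ a₂ a₃ b y ∧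
      (∃ e, x ∈ ends e ∧ ¬ (ends e).IsDiag) ∧ (∃ e, y ∈ ends e ∧ ¬ (ends e).IsDiag)) ∧
    (∀ e, ends e ≠ s(a₁, a₂) ∧ ends e ≠ s(a₁, a₃) ∧ ends e ≠ s(a₂, a₃))) ∧
    ¬ HasHat ends o a₁ a₂ a₃ b ∧
    (∀ u, Unmarked o a₁ a₂ a₃ b u → ∀ e₁ e₂, ends e₁ = s(u, a₁) → ends e₂ = s(u, a₂) →
      4 ≤ nonLoopDeg ends u) :=
  ⟨shape_of_wredMinHAZ h.toWReducedMinHAZ h12 h13 h23 ho1 ho2 ho3 hob hb1 hb2 hb3, h.noHat,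
   fun _ hu _ _ h1 h2 => deg_ge_four_of_wredMinHAZH h h12 hu h1 h2⟩

end Shape

end WRed

end Summit.Ventures.PercRepro2
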